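import Mathlib
import Summits.Langlands.Langlands.Statement
import Summits.Langlands.Langlands.Theorems.ParityBlindBianchiIcosahedralDescentLevelAuxPrime
import Summits.Langlands.Langlands.Theorems.ParityBlindBianchiIcosahedralDescentLevelInert
import Summits.Langlands.Langlands.Theorems.ParityBlindBianchiIcosahedralDescentLevelWitness
import Summits.Langlands.Langlands.Theorems.ParityBlindBianchiIcosahedralDescentLevelAnchor
import Summits.Langlands.Langlands.Theorems.ParityBlindBianchiIcosahedralDescentLevelCaseB
import Summits.Langlands.Langlands.Theorems.ParityBlindBianchiIcosahedralDescentLevelReadOff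
import Summits.Langlands.Langlands.Theorems.ParityBlindBianchiIcosahedralDescentLevelTransfer
import Summits.Langlands.Langlands.Theorems.ParityBlindBianchiIcosahedralQuadraticDescentFrobRoots
import Summits.Langlands.Langlands.Theorems.ParityBlindBianchiIcosahedralQuadraticDescentFields
import Summits.Langlands.Langlands.Theorems.ParityBlindBianchiIcosahedralQuadraticDescentCompositum
import Literature.NumberTheory.Automorphic.TunnellLemma
import Literature.NumberTheory.Automorphic.BaseChangeStrongUnramified
import Literature.NumberTheory.Automorphic.BaseChangeCyclicCuspidal
import Literature.NumberTheory.Automorphic.TunnellOctahedralGlobalProofs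
import Literature.NumberTheory.Automorphic.AutomorphicRepsGLSatakeFlathProofs
import Literature.NumberTheory.Automorphic.GLnAdelicStructureProofs

/-!
# Uniform quadratic descent for the crux `IcosahedralDescentLevel` (stmt-Langlands-15113, line `Sketch`): the repaired statement from Arthur–Clozel's base-change facts

THE CRUX AS TYPED IS MISSTATED: its hypothesis `∃ S₀ : Finset ℕ, …` admits `S₀ = {0}`, for which no
place is good and the compatibility clause is vacuous (landed: p90502
`Theorems/IcosahedralDescentLevel/Negative/AllParityOfDoorOfDescent.lean`), so as typed it contains
all-parity icosahedral strong Artin over `ℚ`.  This skeleton proves the REPAIRED statement (`0 ∉ S₀`)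
from the four named base-change facts of the tree

* F1 `cuspidal_descent_cyclic` (Arthur–Clozel III.4.2 (d)),
* F2 `ArthurClozel1989_strongLifting_unramified` (A–C III.5.1 at unramified places),
* F3 `baseChange_cyclic_cuspidal` (A–C III.4.2 (a)),
* F4 `ArthurClozel_fibres_quadratic` (A–C III.3.1),

and the proved ones (`exists_twist_quadraticSign_holds`, `hasSatakeParamAt_unique_holds`,
`hasSatakeParamAt_cofinite_holds`, `chebotarev_artinRep_holds`, `exists_contragredient_satake_holds`,
`isCompact_glFiniteIntegralLevel_holds`).  Main results: `exists_isPiOfArtinRep_of_uniform` (the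
`ι`-free form) and `icosahedralDescentLevel_repaired` (the crux's statement with `0 ∉ S₀`, in the
summit's `2`-adic packaging), both CONDITIONAL on F1–F4 (explicit hypotheses).  The typed crux is NOT
concluded here (it would need the misstatement bridge; see the line's skeleton `Lines/Sketch.lean`).

Proof (ι-free form `exists_isPiOfArtinRep_of_uniform`): witness prime `ℓ₁` with `ρ(Frob) = 1`
(Chebotarev, `g = 1`); anchor `K₁ = ℚ(√-D₁)` with `2, ℓ₁` split; `π` := descent of `P_{K₁}` (F1),
`t_{π,ℓ₁} = {1,1}` exactly (F2); `π♭ := π ⊗ η_{K₁}` (proved twist fact).  For every PAIR of good places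
`v, v'` of `ℚ` one auxiliary `K = ℚ(√-D)` with `2, p, p'` split and `ℓ₁` inert; `Π := BC_K(π)` cuspidal
(F3, witness `ℓ₁`); A–C 3.1 over `K` w.r.t. `L = K(√-D₁)` (hypothesis from
`eventually_map_pow_eq_of_lifts`): Case A ⇒ `P_K` weak lift of `π` ⇒ (F2) `π` exact at `v, v'`;
Case B ⇒ (splitting law) `P_K` weak lift of `π♭` ⇒ `π♭` exact at `v, v'`.  Pure logic then gives
`π` exact at every good place or `π♭` exact at every good place; good = cofinite.
-/

-- `Summit.Langlands.Langlands.…`: the repeated path component is the tree's layout (D-0017).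
set_option linter.dupNamespace false

noncomputable section

open scoped MatrixGroups NumberField Polynomial Classical
open NumberField IsDedekindDomain Field Filter
open Literature.NumberTheory.Automorphic Literature.NumberTheory.GaloisRepresentations
open Literature.NumberTheory.GaloisRepresentations.QuadraticFamily
open Summit.Langlands.Langlands.Theorems.IcosahedralQuadraticDescent

namespace Summit.Langlands.Langlands.Theorems.IcosahedralDescentLevel

/-! ## Lemmas of the line (the registered stubs are imported from their landed files) -/

/-- With `0 ∉ S₀`, all but finitely many finite places of a number field `K` are good (`ℓ ∉ w`
for every `ℓ ∈ S₀`): finitely many primes contain a given non-zero element. [folklore] -/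
theorem eventually_good (S₀ : Finset ℕ) (h0 : (0 : ℕ) ∉ S₀) (K : Type) [Field K]
    [NumberField K] :
    ∀ᶠ w : HeightOneSpectrum (𝓞 K) in cofinite, ∀ ℓ ∈ S₀, ((ℓ : ℕ) : 𝓞 K) ∉ w.asIdeal := by
  simp only [Filter.eventually_all_finset]
  intro ℓ hℓ
  have hℓ0 : ((ℓ : ℕ) : 𝓞 K) ≠ 0 := by
    have : ℓ ≠ 0 := fun h => h0 (h ▸ hℓ)
    exact_mod_cast this
  have hfin := Ideal.finite_factors
    ((Ideal.span_singleton_eq_bot (α := 𝓞 K)).not.mpr hℓ0 : Ideal.span {((ℓ : ℕ) : 𝓞 K)} ≠ ⊥)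
  rw [Filter.eventually_cofinite]
  refine hfin.subset fun w hw => ?_
  simp only [Set.mem_setOf_eq, not_not] at hw
  exact Ideal.dvd_span_singleton.mpr hw

/-- A place `w ∣ v` of `K/ℚ` is good iff `v` is. [folklore] -/
theorem good_iff_under (S₀ : Finset ℕ) (K : Type) [Field K] [NumberField K]
    (w : HeightOneSpectrum (𝓞 K)) (v : HeightOneSpectrum (𝓞 ℚ))
    (hw : w.asIdeal.under (𝓞 ℚ) = v.asIdeal) :
    (∀ ℓ ∈ S₀, ((ℓ : ℕ) : 𝓞 K) ∉ w.asIdeal) ↔ ∀ ℓ ∈ S₀, ((ℓ : ℕ) : 𝓞 ℚ) ∉ v.asIdeal := by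
  refine forall₂_congr fun ℓ _ => not_congr ?_
  rw [← hw]
  change _ ↔ ((ℓ : ℕ) : 𝓞 ℚ) ∈ Ideal.comap (algebraMap (𝓞 ℚ) (𝓞 K)) w.asIdeal
  rw [Ideal.mem_comap, map_natCast]

/-- Uniqueness / almost-everywhere existence of Satake parameters (proved facts of the tree), in the
polymorphic form the base-change glue lemmas consume. [folklore] -/
theorem satake_unique {n : ℕ} {K : Type} [Field K] [NumberField K] {hc : isCompact_glFiniteIntegralLevel n K}
    (π : AutomorphicRepData (AutomorphyDatum.gl n K hc)) : π.hasSatakeParamAt_unique :=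
  AutomorphicRepData.hasSatakeParamAt_unique_holds π

/-- Almost-everywhere existence of Satake parameters (proved fact of the tree). [folklore] -/
theorem satake_cofinite {n : ℕ} {K : Type} [Field K] [NumberField K] {hc : isCompact_glFiniteIntegralLevel n K}
    (π : AutomorphicRepData (AutomorphyDatum.gl n K hc)) : π.hasSatakeParamAt_cofinite :=
  AutomorphicRepData.hasSatakeParamAt_cofinite_holds π

/-- **The per-pair dichotomy** (the lead's stub, composed).  Fix the anchor data: `K₁ = ℚ(√-D₁)`
(`D₁` prime), the witness place `v₁ ∋ ℓ₁` (odd prime), cuspidal `π, π♭` on `GL₂(𝔸_ℚ)` with `P₁` a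
weak lift of `π`, `t_{π,v₁} = {1,1}` and `π♭ = π ⊗ η_{K₁}` a.e.; and the uniform family `hK`.  Then for
every two good places `v ∋ p`, `v' ∋ p'` of `ℚ` (odd primes off `ℓ₁, D₁`, off `S₀`, unramified for
`ρ`) either `π` is Frobenius–Satake compatible with `ρ` at both, or `π♭` is.  Proof: auxiliary field
`K = ℚ(√-D)` with `2, p, p'` split and `ℓ₁` inert (`exists_auxPrime`, `inertiaDeg_eq_two_of_nonsquare`); `Q = BC_K(π)`
cuspidal (F3, witness `v₁`); A–C 3.1 over `K` w.r.t. `L = K(√-D₁)` (F4; hypothesis by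
`eventually_map_pow_eq_of_lifts`); Case A ⇒ `P_K` weak lift of `π`, Case B ⇒ weak lift of `π♭`
(`isWeakBaseChangeLiftAE_twist_of_caseB` with the splitting law `eventually_quadraticSign_eq_pow`); F2 read-off at `v, v'`
(`frobSatakeCompatibleAt_of_weakLift_split`). [folklore] -/
theorem pair_dichotomy (hSL : ArthurClozel1989_strongLifting_unramified)
    (hBC : baseChange_cyclic_cuspidal) (hfib : ArthurClozel_fibres_quadratic)
    (ρ : FramedArtinRep ℚ 2) (S₀ : Finset ℕ) (h0 : (0 : ℕ) ∉ S₀)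
    (hK : ∀ (K : Type) [Field K] [NumberField K], IsTotallyComplex K → Module.finrank ℚ K = 2 →
      (∃ v w : HeightOneSpectrum (𝓞 K), v ≠ w ∧ ((2 : ℕ) : 𝓞 K) ∈ v.asIdeal ∧
        ((2 : ℕ) : 𝓞 K) ∈ w.asIdeal) →
      ∃ (hc : isCompact_glFiniteIntegralLevel 2 K) (P : CuspidalAutomorphicRepData 2 K hc),
        ∀ w : HeightOneSpectrum (𝓞 K), (∀ ℓ ∈ S₀, ((ℓ : ℕ) : 𝓞 K) ∉ w.asIdeal) →
          FrobSatakeCompatibleAt (ρ.restrictField K) P.1 w)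
    (D₁ : ℕ) (hD₁ : D₁.Prime) [Fact (¬ IsSquare (-(D₁ : ℚ)))]
    (hK₁ : isCompact_glFiniteIntegralLevel 2 (sqrtNegField ℚ D₁))
    (P₁ : CuspidalAutomorphicRepData 2 (sqrtNegField ℚ D₁) hK₁)
    (hP₁ : IsPiOfArtinRep (ρ.restrictField (sqrtNegField ℚ D₁)) P₁.1)
    (v₁ : HeightOneSpectrum (𝓞 ℚ)) (ℓ₁ : ℕ) (hℓ₁ : ℓ₁.Prime) (hℓ₁2 : ℓ₁ ≠ 2)
    (hℓ₁v : ((ℓ₁ : ℕ) : 𝓞 ℚ) ∈ v₁.asIdeal)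
    (hQ : isCompact_glFiniteIntegralLevel 2 ℚ) (π πf : CuspidalAutomorphicRepData 2 ℚ hQ)
    (hlift₁ : IsWeakBaseChangeLiftAE π.1 P₁.1) (hπv₁ : π.1.HasSatakeParamAt v₁ {1, 1})
    (htw : ∀ᶠ v : HeightOneSpectrum (𝓞 ℚ) in cofinite, ∀ α : Multiset ℂ,
      π.1.HasSatakeParamAt v α →
        πf.1.HasSatakeParamAt v (α.map (quadraticSign (sqrtNegField ℚ D₁) v * ·)))
    (v v' : HeightOneSpectrum (𝓞 ℚ)) (p p' : ℕ) (hp : p.Prime) (hp' : p'.Prime)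
    (hpv : ((p : ℕ) : 𝓞 ℚ) ∈ v.asIdeal) (hp'v : ((p' : ℕ) : 𝓞 ℚ) ∈ v'.asIdeal)
    (hp2 : p ≠ 2) (hp'2 : p' ≠ 2) (hpℓ : p ≠ ℓ₁) (hp'ℓ : p' ≠ ℓ₁)
    (hgood : ∀ ℓ ∈ S₀, ((ℓ : ℕ) : 𝓞 ℚ) ∉ v.asIdeal) (hgood' : ∀ ℓ ∈ S₀, ((ℓ : ℕ) : 𝓞 ℚ) ∉ v'.asIdeal)
    (hρv : ρ.IsUnramifiedAt v) (hρv' : ρ.IsUnramifiedAt v') :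
    (FrobSatakeCompatibleAt ρ π.1 v ∧ FrobSatakeCompatibleAt ρ π.1 v') ∨
      (FrobSatakeCompatibleAt ρ πf.1 v ∧ FrobSatakeCompatibleAt ρ πf.1 v') := by
  classical
  -- the auxiliary field `K = ℚ(√-D)`: `2, p, p'` split, `ℓ₁` inert, `D ≠ D₁`
  obtain ⟨D, hD, hDgt, h16, h8p, h8p', hns⟩ :=
    exists_auxPrime ℓ₁ hℓ₁ hℓ₁2 p p' hp hp' hp2 hp'2 hpℓ hp'ℓ D₁
  haveI hF : Fact (¬ IsSquare (-(D : ℚ))) := fact_not_isSquare_neg_natCast hD.pos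
  haveI : Algebra.IsQuadraticExtension ℚ (sqrtNegField ℚ D) := ⟨finrank_sqrtNegField⟩
  haveI : IsGalois ℚ (sqrtNegField ℚ D) := inferInstance
  have h2K : Module.finrank ℚ (sqrtNegField ℚ D) = 2 := finrank_sqrtNegField
  obtain ⟨hKc, P, hP⟩ := hK (sqrtNegField ℚ D) (isTotallyComplex_sqrtNegField hD.pos) h2K
    (exists_two_places_two_mem h16)
  have hPae : IsPiOfArtinRep (ρ.restrictField (sqrtNegField ℚ D)) P.1 := by
    filter_upwards [eventually_good S₀ h0 (sqrtNegField ℚ D)] with w hw using hP w hw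
  -- `Q = BC_K(π)` cuspidal: the witness is `v₁` (`ℓ₁` inert in `K`, `t_{π,v₁} = {1,1}`)
  obtain ⟨u₁, hu₁⟩ := exists_above (E := sqrtNegField ℚ D) v₁
  have hf₁ : u₁.asIdeal.inertiaDeg (𝓞 ℚ) = Module.finrank ℚ (sqrtNegField ℚ D) := by
    rw [h2K]; exact inertiaDeg_eq_two_of_nonsquare D ℓ₁ hℓ₁ hns v₁ hℓ₁v u₁ hu₁
  have hprime : (Module.finrank ℚ (sqrtNegField ℚ D)).Prime := by rw [h2K]; exact Nat.prime_two
  have hsum : (({1, 1} : Multiset ℂ)).sum ≠ 0 := by norm_num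
  obtain ⟨Q, hQlift⟩ := hBC 2 ℚ (sqrtNegField ℚ D) hprime hQ π
    ⟨v₁, u₁, {1, 1}, hu₁, hf₁, hπv₁, fun ζ hζ => map_neg_ne_of_sum_ne_zero hsum (by rwa [h2K] at hζ)⟩
    hKc
  -- the compositum `L = K(√-D₁)`, quadratic over `K`
  have hne : D ≠ D₁ := (ne_of_lt hDgt).symm
  haveI : Fact (¬ IsSquare (-(D₁ : sqrtNegField ℚ D))) :=
    ⟨not_isSquare_neg_natCast_sqrtNegField D₁ D (not_isSquare_ratCast_mul hD hD₁ hne)⟩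
  have h2L : Module.finrank (sqrtNegField ℚ D) (compositum D₁ D) = 2 := finrank_sqrtNegField
  -- Arthur–Clozel 3.1 over `K` w.r.t. `L`: hypothesis by transitivity through `K₁`
  have H := eventually_map_pow_eq_of_lifts (F := ℚ) (E := sqrtNegField ℚ D₁) (K := sqrtNegField ℚ D)
    (M := compositum D₁ D) ρ (eventually_isUnramifiedAt ρ) hP₁ hPae hlift₁ hQlift (satake_unique P₁.1)
    (satake_unique P.1) (satake_unique Q.1) (satake_cofinite π.1)
  have H' : ∀ᶠ x : HeightOneSpectrum (𝓞 (compositum D₁ D)) in cofinite,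
      ∀ (w : HeightOneSpectrum (𝓞 (sqrtNegField ℚ D))) (α α' : Multiset ℂ),
        x.asIdeal.under (𝓞 (sqrtNegField ℚ D)) = w.asIdeal → Q.1.HasSatakeParamAt w α →
          P.1.HasSatakeParamAt w α' →
            α.map (· ^ x.asIdeal.inertiaDeg (𝓞 (sqrtNegField ℚ D))) =
              α'.map (· ^ x.asIdeal.inertiaDeg (𝓞 (sqrtNegField ℚ D))) :=
    H.mono fun x hx w α α' hxw hα hα' => (hx w α' α hxw hα' hα).symm
  -- the read-off at a good split place, for any cuspidal `x` of which `P` is a weak lift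
  have readOff : ∀ (x : CuspidalAutomorphicRepData 2 ℚ hQ), IsWeakBaseChangeLiftAE x.1 P.1 →
      ∀ (u : HeightOneSpectrum (𝓞 ℚ)) (q : ℕ), q.Prime → ((q : ℕ) : 𝓞 ℚ) ∈ u.asIdeal →
        8 * q ∣ D + 1 → (∀ ℓ ∈ S₀, ((ℓ : ℕ) : 𝓞 ℚ) ∉ u.asIdeal) → ρ.IsUnramifiedAt u →
          FrobSatakeCompatibleAt ρ x.1 u := by
    intro x hx u q hq hqu h8q hgu hρu
    obtain ⟨hunr, hdeg, -⟩ := split_of_dvd (D := D) hq hqu h8q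
    exact frobSatakeCompatibleAt_of_weakLift_split hSL ρ (sqrtNegField ℚ D) h2K hQ hKc x P hx u hunr hdeg hρu
      fun w hw => hP w ((good_iff_under S₀ _ w u hw).mpr hgu)
  rcases hfib 2 (sqrtNegField ℚ D) (compositum D₁ D) h2L hKc Q P H' with hA | hB
  · -- Case A: `P` is a weak lift of `π`
    have hliftP : IsWeakBaseChangeLiftAE π.1 P.1 :=
      (hQlift.and hA).mono fun w ⟨h1, h2⟩ u α hu hα => h2 _ (h1 u α hu hα)
    exact Or.inl ⟨readOff π hliftP v p hp hpv h8p hgood hρv,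
      readOff π hliftP v' p' hp' hp'v h8p' hgood' hρv'⟩
  · -- Case B: `P` is a weak lift of `π♭` (splitting law for `L/K` against `K₁/ℚ`)
    have hliftP : IsWeakBaseChangeLiftAE πf.1 P.1 :=
      isWeakBaseChangeLiftAE_twist_of_caseB (sqrtNegField ℚ D₁) (sqrtNegField ℚ D) (compositum D₁ D) hQ hKc π πf Q P hQlift hB
        (eventually_quadraticSign_eq_pow D₁ D finrank_sqrtNegField h2L) htw
    exact Or.inr ⟨readOff πf hliftP v p hp hpv h8p hgood hρv,
      readOff πf hliftP v' p' hp' hp'v h8p' hgood' hρv'⟩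

/-! ## Composition -/

/-- Pure logic: a pairwise-constant dichotomy is globally constant. [folklore] -/
theorem forall_or_forall_of_pairwise {α : Type*} (G : Set α) (A B : α → Prop)
    (h : ∀ a ∈ G, ∀ b ∈ G, (A a ∧ A b) ∨ (B a ∧ B b)) :
    (∀ a ∈ G, A a) ∨ (∀ a ∈ G, B a) := by
  by_contra hc
  push Not at hc
  obtain ⟨⟨a, ha, hA⟩, ⟨b, hb, hB⟩⟩ := hc
  rcases h a ha b hb with ⟨h1, -⟩ | ⟨-, h2⟩
  · exact hA h1
  · exact hB h2

/-- Finitely many finite places of `ℚ` contain a given non-zero natural number. [folklore] -/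
theorem finite_setOf_natCast_mem {n : ℕ} (hn : n ≠ 0) :
    {v : HeightOneSpectrum (𝓞 ℚ) | ((n : ℕ) : 𝓞 ℚ) ∈ v.asIdeal}.Finite := by
  have h := eventually_good {n} (by simpa using hn.symm) ℚ
  rw [Filter.eventually_cofinite] at h
  refine h.subset fun v hv => ?_
  simpa using hv

/-- **Uniform quadratic descent, `ι`-free form** (the transfer `C⁺` of the line): for a rank-two Artin
representation `ρ` of `ℚ` and a finite set of NON-ZERO naturals `S₀`, a family of cuspidal `P_K` on
`GL₂(𝔸_K)`, one for every imaginary quadratic `K` with `2` split, each Frobenius–Satake compatible with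
`ρ|_K` at every place over no element of `S₀`, forces a cuspidal `π` on `GL₂(𝔸_ℚ)` with `π = π(ρ)` in
Tunnell's sense — granted F1–F4. [folklore] -/
theorem exists_isPiOfArtinRep_of_uniform (hdesc : cuspidal_descent_cyclic)
    (hSL : ArthurClozel1989_strongLifting_unramified) (hBC : baseChange_cyclic_cuspidal)
    (hfib : ArthurClozel_fibres_quadratic) (ρ : FramedArtinRep ℚ 2) (S₀ : Finset ℕ)
    (h0 : (0 : ℕ) ∉ S₀)
    (hK : ∀ (K : Type) [Field K] [NumberField K], IsTotallyComplex K → Module.finrank ℚ K = 2 →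
      (∃ v w : HeightOneSpectrum (𝓞 K), v ≠ w ∧ ((2 : ℕ) : 𝓞 K) ∈ v.asIdeal ∧
        ((2 : ℕ) : 𝓞 K) ∈ w.asIdeal) →
      ∃ (hc : isCompact_glFiniteIntegralLevel 2 K) (P : CuspidalAutomorphicRepData 2 K hc),
        ∀ w : HeightOneSpectrum (𝓞 K), (∀ ℓ ∈ S₀, ((ℓ : ℕ) : 𝓞 K) ∉ w.asIdeal) →
          FrobSatakeCompatibleAt (ρ.restrictField K) P.1 w) :
    ∃ (hQ : isCompact_glFiniteIntegralLevel 2 ℚ) (π : CuspidalAutomorphicRepData 2 ℚ hQ),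
      IsPiOfArtinRep ρ π.1 := by
  classical
  have hQ : isCompact_glFiniteIntegralLevel 2 ℚ := isCompact_glFiniteIntegralLevel_holds 2 ℚ
  -- the finite bad sets over `ℚ`
  have hgoodQ := eventually_good S₀ h0 ℚ
  have hram := eventually_isUnramifiedAt ρ
  have h2fin := finite_setOf_natCast_mem (n := 2) two_ne_zero
  -- the witness place `v₁ ∋ ℓ₁`
  set X₀ : Set (HeightOneSpectrum (𝓞 ℚ)) :=
    {v | ¬ (∀ ℓ ∈ S₀, ((ℓ : ℕ) : 𝓞 ℚ) ∉ v.asIdeal)} ∪ {v | ((2 : ℕ) : 𝓞 ℚ) ∈ v.asIdeal} with hX₀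
  have hX₀fin : X₀.Finite := by
    refine Set.Finite.union ?_ h2fin
    rw [Filter.eventually_cofinite] at hgoodQ
    exact hgoodQ
  obtain ⟨v₁, ℓ₁, hv₁X, hℓ₁, hℓ₁2, hℓ₁v, hρ₁, hroots₁⟩ := exists_witness_place ρ X₀ hX₀fin
  have hgood₁ : ∀ ℓ ∈ S₀, ((ℓ : ℕ) : 𝓞 ℚ) ∉ v₁.asIdeal := by
    by_contra h; exact hv₁X (Or.inl h)
  -- the anchor field `K₁ = ℚ(√-D₁)`, `16 ℓ₁ ∣ D₁ + 1`
  obtain ⟨D₁, hD₁, -, hD₁dvd⟩ := exists_prime_gt_and_dvd_succ (16 * ℓ₁) (mul_ne_zero (by norm_num) hℓ₁.ne_zero) 0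
  haveI hF₁ : Fact (¬ IsSquare (-(D₁ : ℚ))) := fact_not_isSquare_neg_natCast hD₁.pos
  haveI : Algebra.IsQuadraticExtension ℚ (sqrtNegField ℚ D₁) := ⟨finrank_sqrtNegField⟩
  have h16 : 16 ∣ D₁ + 1 := (Dvd.intro _ rfl : 16 ∣ 16 * ℓ₁).trans hD₁dvd
  have h8ℓ : 8 * ℓ₁ ∣ D₁ + 1 := dvd_trans ⟨2, by ring⟩ hD₁dvd
  obtain ⟨hK₁, P₁, hP₁⟩ := hK (sqrtNegField ℚ D₁) (isTotallyComplex_sqrtNegField hD₁.pos)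
    finrank_sqrtNegField (exists_two_places_two_mem h16)
  -- `P₁ = π(ρ|K₁)` almost everywhere
  have hP₁ae : IsPiOfArtinRep (ρ.restrictField (sqrtNegField ℚ D₁)) P₁.1 := by
    filter_upwards [eventually_good S₀ h0 (sqrtNegField ℚ D₁)] with w hw using hP₁ w hw
  -- descent, exactness at `v₁`, twist
  obtain ⟨hunr₁, hdeg₁, -⟩ := split_of_dvd (D := D₁) hℓ₁ hℓ₁v h8ℓ
  have hcompat₁ : ∀ w : HeightOneSpectrum (𝓞 (sqrtNegField ℚ D₁)),
      w.asIdeal.under (𝓞 ℚ) = v₁.asIdeal →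
        FrobSatakeCompatibleAt (ρ.restrictField (sqrtNegField ℚ D₁)) P₁.1 w :=
    fun w hw => hP₁ w ((good_iff_under S₀ _ w v₁ hw).mpr hgood₁)
  obtain ⟨π, πf, hlift₁, hπv₁, htw⟩ := anchor_descent hdesc hSL ρ (sqrtNegField ℚ D₁)
    finrank_sqrtNegField hK₁ P₁ hP₁ae v₁ hunr₁ hdeg₁ hcompat₁ hρ₁ hroots₁ hQ
  -- the good places and the pairwise dichotomy
  set G : Set (HeightOneSpectrum (𝓞 ℚ)) :=
    {v | (∀ ℓ ∈ S₀, ((ℓ : ℕ) : 𝓞 ℚ) ∉ v.asIdeal) ∧ ρ.IsUnramifiedAt v ∧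
      ((2 : ℕ) : 𝓞 ℚ) ∉ v.asIdeal ∧ ((ℓ₁ : ℕ) : 𝓞 ℚ) ∉ v.asIdeal} with hG
  have hGcof : ∀ᶠ v : HeightOneSpectrum (𝓞 ℚ) in cofinite, v ∈ G := by
    have h3 := finite_setOf_natCast_mem (n := ℓ₁) hℓ₁.ne_zero
    filter_upwards [hgoodQ, hram, h2fin.compl_mem_cofinite, h3.compl_mem_cofinite] with v a b c d
      using ⟨a, b, c, d⟩
  have key : ∀ v ∈ G, ∀ v' ∈ G,
      (FrobSatakeCompatibleAt ρ π.1 v ∧ FrobSatakeCompatibleAt ρ π.1 v') ∨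
        (FrobSatakeCompatibleAt ρ πf.1 v ∧ FrobSatakeCompatibleAt ρ πf.1 v') := by
    intro v hv v' hv'
    obtain ⟨hg, hρv, h2v, hℓv⟩ := hv
    obtain ⟨hg', hρv', h2v', hℓv'⟩ := hv'
    obtain ⟨p, hp, hpv⟩ := exists_prime_natCast_mem v
    obtain ⟨p', hp', hp'v⟩ := exists_prime_natCast_mem v'
    have ne_of : ∀ {q : ℕ} {u : HeightOneSpectrum (𝓞 ℚ)}, ((q : ℕ) : 𝓞 ℚ) ∈ u.asIdeal →
        ∀ {r : ℕ}, ((r : ℕ) : 𝓞 ℚ) ∉ u.asIdeal → q ≠ r := by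
      intro q u hq r hr hqr; exact hr (hqr ▸ hq)
    exact pair_dichotomy hSL hBC hfib ρ S₀ h0 hK D₁ hD₁ hK₁ P₁ hP₁ae v₁ ℓ₁ hℓ₁ hℓ₁2 hℓ₁v hQ π πf
      hlift₁ hπv₁ htw v v' p p' hp hp' hpv hp'v (ne_of hpv h2v) (ne_of hp'v h2v') (ne_of hpv hℓv)
      (ne_of hp'v hℓv') hg hg' hρv hρv'
  rcases forall_or_forall_of_pairwise G _ _ key with hA | hB
  · exact ⟨hQ, π, hGcof.mono hA⟩
  · exact ⟨hQ, πf, hGcof.mono hB⟩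

/-- **The repaired crux D″** (`0 ∉ S₀`) from F1–F4: the statement of
`ParityBlindBianchi.IcosahedralDescentLevel` with the bad set required to consist of non-zero
naturals, in the summit's `2`-adic packaging (transfer through the contragredient and the `m = 1`
arithmetic dictionary of `…IcosahedralQuadraticDescentFrobRoots`). [folklore] -/
theorem icosahedralDescentLevel_repaired (hdesc : cuspidal_descent_cyclic)
    (hSL : ArthurClozel1989_strongLifting_unramified) (hBC : baseChange_cyclic_cuspidal)
    (hfib : ArthurClozel_fibres_quadratic) (ι : PadicAlgCl 2 ≃+* ℂ)
    (ρ : FramedGaloisRep ℚ ℂ 2) (S₀ : Finset ℕ) (h0 : (0 : ℕ) ∉ S₀)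
    (hK : ∀ (K : Type) [Field K] [NumberField K], NumberField.IsTotallyComplex K →
      Module.finrank ℚ K = 2 →
      (∃ v w : IsDedekindDomain.HeightOneSpectrum (NumberField.RingOfIntegers K), v ≠ w ∧
        ((2 : ℕ) : NumberField.RingOfIntegers K) ∈ v.asIdeal ∧
        ((2 : ℕ) : NumberField.RingOfIntegers K) ∈ w.asIdeal) →
      ∃ (σ : FramedGaloisRep K (PadicAlgCl 2) 2)
        (hcpt : isCompact_glFiniteIntegralLevel 2 K) (π : CuspidalAutomorphicRepData 2 K hcpt),
        (∀ (g : absoluteGaloisGroup K) (i j : Fin 2),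
          ι ((σ g).val i j) = ((FramedGaloisRep.restrictField K ρ) g).val i j) ∧
        ∀ w : IsDedekindDomain.HeightOneSpectrum (NumberField.RingOfIntegers K),
          (∀ ℓ ∈ S₀, ((ℓ : ℕ) : NumberField.RingOfIntegers K) ∉ w.asIdeal) →
            Summit.Langlands.SatakeFrobCompatibleAt ι π.1 σ w) :
    ∃ (hcpt : isCompact_glFiniteIntegralLevel 2 ℚ) (π : CuspidalAutomorphicRepData 2 ℚ hcpt),
      ∀ᶠ v : IsDedekindDomain.HeightOneSpectrum (NumberField.RingOfIntegers ℚ) in Filter.cofinite,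
        ∃ α : Multiset ℂ, π.1.HasSatakeParamAt v α ∧ ρ.IsUnramifiedAt v ∧
          ρ.HasFrobCharpolyAt v (satakePolynomial α) := by
  refine exists_isPiOfArtinRep_of_uniform hdesc hSL hBC hfib ρ S₀ h0 ?_
  intro K _ _ htc hdeg hsplit
  obtain ⟨σ, hcpt, π, hmodel, hπ⟩ := hK K htc hdeg hsplit
  obtain ⟨P, hP⟩ := exists_frobSatakeCompatible_of_model ι ρ S₀ K σ hcpt π hmodel hπ
  exact ⟨hcpt, P, hP⟩

/-- The same with the bad set required to consist of PRIMES (the refuters' alternative repair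
`(∀ ℓ ∈ S₀, ℓ.Prime) ∧ …`): immediate from `icosahedralDescentLevel_repaired`, as `0` is not prime.
[folklore] -/
theorem icosahedralDescentLevel_repaired_prime (hdesc : cuspidal_descent_cyclic)
    (hSL : ArthurClozel1989_strongLifting_unramified) (hBC : baseChange_cyclic_cuspidal)
    (hfib : ArthurClozel_fibres_quadratic) (ι : PadicAlgCl 2 ≃+* ℂ)
    (ρ : FramedGaloisRep ℚ ℂ 2) (S₀ : Finset ℕ) (hS₀ : ∀ ℓ ∈ S₀, ℓ.Prime)
    (hK : ∀ (K : Type) [Field K] [NumberField K], NumberField.IsTotallyComplex K →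
      Module.finrank ℚ K = 2 →
      (∃ v w : IsDedekindDomain.HeightOneSpectrum (NumberField.RingOfIntegers K), v ≠ w ∧
        ((2 : ℕ) : NumberField.RingOfIntegers K) ∈ v.asIdeal ∧
        ((2 : ℕ) : NumberField.RingOfIntegers K) ∈ w.asIdeal) →
      ∃ (σ : FramedGaloisRep K (PadicAlgCl 2) 2)
        (hcpt : isCompact_glFiniteIntegralLevel 2 K) (π : CuspidalAutomorphicRepData 2 K hcpt),
        (∀ (g : absoluteGaloisGroup K) (i j : Fin 2),
          ι ((σ g).val i j) = ((FramedGaloisRep.restrictField K ρ) g).val i j) ∧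
        ∀ w : IsDedekindDomain.HeightOneSpectrum (NumberField.RingOfIntegers K),
          (∀ ℓ ∈ S₀, ((ℓ : ℕ) : NumberField.RingOfIntegers K) ∉ w.asIdeal) →
            Summit.Langlands.SatakeFrobCompatibleAt ι π.1 σ w) :
    ∃ (hcpt : isCompact_glFiniteIntegralLevel 2 ℚ) (π : CuspidalAutomorphicRepData 2 ℚ hcpt),
      ∀ᶠ v : IsDedekindDomain.HeightOneSpectrum (NumberField.RingOfIntegers ℚ) in Filter.cofinite,
        ∃ α : Multiset ℂ, π.1.HasSatakeParamAt v α ∧ ρ.IsUnramifiedAt v ∧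
          ρ.HasFrobCharpolyAt v (satakePolynomial α) :=
  icosahedralDescentLevel_repaired hdesc hSL hBC hfib ι ρ S₀ (fun h0 => Nat.not_prime_zero (hS₀ 0 h0)) hK

/-- **Option (b) for the planner's restatement, closable NOW**: the repaired crux D″ with the four
Arthur–Clozel facts as antecedents, `F1 → F2 → F3 → F4 → D″`, in the route's verbatim vocabulary.
A restated item with exactly this signature is closed by this theorem. [folklore] -/
theorem icosahedralDescentLevel_conditional :
    cuspidal_descent_cyclic → ArthurClozel1989_strongLifting_unramified →
      baseChange_cyclic_cuspidal → ArthurClozel_fibres_quadratic →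
    ∀ (ι : PadicAlgCl 2 ≃+* ℂ) (ρ : FramedGaloisRep ℚ ℂ 2), ρ.toGaloisRep.IsIrreducible →
      Nonempty ((Matrix.ProjGenLinGroup.mk.comp ρ.toMonoidHom).range ≃* alternatingGroup (Fin 5)) →
      (∃ S₀ : Finset ℕ, (0 : ℕ) ∉ S₀ ∧ ∀ (K : Type) [Field K] [NumberField K],
        NumberField.IsTotallyComplex K → Module.finrank ℚ K = 2 →
        (∃ v w : IsDedekindDomain.HeightOneSpectrum (NumberField.RingOfIntegers K), v ≠ w ∧
          ((2 : ℕ) : NumberField.RingOfIntegers K) ∈ v.asIdeal ∧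
          ((2 : ℕ) : NumberField.RingOfIntegers K) ∈ w.asIdeal) →
        ∃ (σ : FramedGaloisRep K (PadicAlgCl 2) 2)
          (hcpt : isCompact_glFiniteIntegralLevel 2 K) (π : CuspidalAutomorphicRepData 2 K hcpt),
          (∀ (g : absoluteGaloisGroup K) (i j : Fin 2),
            ι ((σ g).val i j) = ((FramedGaloisRep.restrictField K ρ) g).val i j) ∧
          ∀ w : IsDedekindDomain.HeightOneSpectrum (NumberField.RingOfIntegers K),
            (∀ ℓ ∈ S₀, ((ℓ : ℕ) : NumberField.RingOfIntegers K) ∉ w.asIdeal) →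
              Summit.Langlands.SatakeFrobCompatibleAt ι π.1 σ w) →
      ∃ (hcpt : isCompact_glFiniteIntegralLevel 2 ℚ) (π : CuspidalAutomorphicRepData 2 ℚ hcpt),
        ∀ᶠ v : IsDedekindDomain.HeightOneSpectrum (NumberField.RingOfIntegers ℚ) in Filter.cofinite,
          ∃ α : Multiset ℂ, π.1.HasSatakeParamAt v α ∧ ρ.IsUnramifiedAt v ∧
            ρ.HasFrobCharpolyAt v (satakePolynomial α) :=
  fun hdesc hSL hBC hfib ι ρ _ _ ⟨S₀, h0, hK⟩ =>
    icosahedralDescentLevel_repaired hdesc hSL hBC hfib ι ρ S₀ h0 hK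

end Summit.Langlands.Langlands.Theorems.IcosahedralDescentLevel

end
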